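import Summits.ResolutionOfSingularities.ResolutionOfSingularities.Theorems.MarkedTransferCampaignW46TypedProcedureAnchors
import Literature.AlgebraicGeometry.Resolution.EffectiveResolutionDischarges
import HarnessLib

/-!
# [OURS · L1 W4.6, rung (iv) «large characteristic»] What the typed Th. 16.6 procedure does and does not give for
# `p` large relative to dimension / degree — theorems over `Theorems/MarkedTransferCampaignW46TypedProcedure.lean`
# (cell res-hironaka, LADDER-RESOLUTION rung L, D-0089; slot W4.6, seat res-L1-s46-pv-7; host route MarkedTransfer,
# `--supports stmt-ResolutionOfSingularities-16155 --as helper`)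

HONEST FRAMING. Nothing here is a statement of H. Hironaka's manuscript (2017-03-23, [Hironaka2017]) and nothing here
asserts that any statement of it holds. The theorems are (a) PURE LOGIC / elementary order theory about the OURS
definitions of the typed-procedure module (`CampaignW46.Resume`, `Step`, `Step.Decrease`, `DecreaseAlongSteps`,
`Terminates`, `TerminatesNabla`, `Regime.charGT`; res-L1-type-o1) and the typed CANDIDATE carriers under them (row 019
`S16Proof.MTIDatum`, `InvString.LexLT` = the 0-padded order of Eq. (127); row 094 `YTerminal`; row 091
`YSequence.genDegOne`), which enter as DEFINITIONS and HYPOTHESES only; (b) one re-export, in the campaign's shape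
«`p > C(n, d)`», of a theorem the TREE proves (`Resolution.BierstoneGrigorievMilmanWlodarczyk2011_holds`; no premise of
the manuscript, no FACT-LIST premise). AI review is weaker than expert review. No `sorry`; axioms standard.

## What rung (iv) splits into (target «the typed procedure terminates for `p > C(n, d)` — honest `C`; reduction to
## the char-0-like regime», RESCUE-SEED §1 row W4.6 (iv))

(iv-a) EXISTENCE of resolutions for `p` large relative to (embedding dimension, degree, number of equations) is a
THEOREM OF THE TREE: `largeChar_hypersurface_hasResolution` / `largeChar_boundedComplexity_hasResolution` below put
`BierstoneGrigorievMilmanWlodarczyk2011_holds` (Kollár's char-0 Thms. 3.103/3.107 proved in tree + spreading out +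
Noetherian induction `LargeCharacteristic.exists_bound_forall_prime_of_generic`) in the shape «`∀ n d, ∃ p₀, ∀ p > p₀`».
The threshold is NOT explicit in the tree's proof (BGMW's printed `M(d, n, l) ∈ 𝓔^{n+3}` is not transcribed), and for
EXISTENCE no lower bound on `C` can exist (resolution is expected in every characteristic): the «honest `C`» question
is a question about the typed PROCEDURE, (iv-b).

(iv-b) THE TYPED ONE-STEP CERTIFICATE Eq. (127) IN THE TAME REGIME. «Large `p`» is the regime in which the résumé is
meant to be CLASSICAL: every member of `𝔜(0)` has `℘` generated in degree one (no wild `q = p^e > 1`; prior V5 «wild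
data reappear at level 1 via `b!`»: this needs `p > b!`, not only `p > b`; the CJS bound behind the barrier
`Literature.Barriers.ResolutionOfSingularities.DirectrixSmallCharacteristic.hironakaQuadric_directrixZero_and_nearPoint`
needs `p ≥ dim/2 + 1`). In the typed vocabulary that is EXACTLY «the terminal index of Def. 15.11 is `t = 0`»
(`Resume.m_eq_zero_iff_genDegOne_zero`), hence, under the module's DESIGN POINT (M) `m := t`, the unprimed `Inv`-string
of Eq. (127) is EMPTY, and no string is `<_lex` the empty string after 0-padding (`invString_not_lexLT_nil`). Pure-logic
consequences: from a résumé terminal at stage `0`, Eq. (127)-for-a-step holds iff NO closed point lies over the centre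
off `D′` (`Step.decrease_iff_of_m_eq_zero`); for the ∇-centred step of Th. 16.6 (4) («`D = ∇`», irreducible `∇`)
`D′ = ∅`, so iff no closed point lies over the centre at all (`Step.decrease_iff_of_m_eq_zero_of_nabla_subset`); and ONE
tame witness (state in the regime, résumé terminal at stage `0`, a step, a résumé of the transform, a closed point over
the centre off `D′`) refutes `DecreaseAlongSteps N Rd Rg` for every regime containing the state — in particular every
`Regime.charGT n C` (`not_decreaseAlongSteps_charGT_of_tameWitness`). READING, NOT A VERDICT: a property of the typed
TRANSCRIPTION under (M) (with `m := t + 1` the strings are non-empty and the question becomes K4.6's stall question,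
KILL-TEST-K4.6.md §4 (iv′)); it says the (127)-reading of rung (iv) is not the bankable one — a typed rung (iv) must be a
TERMINATION statement proved from a state measure, as rungs (ii)/(iii) are (res-L1-s46-pv-4, res-L1-s46-pv-5).

(iv-d) HOW A TERMINATION RUNG IS PROVED (pure logic): a natural-number state measure dropping along every (∇-)step
inside the regime gives `Terminates` / `TerminatesNabla` (`terminates_of_stepMeasure`, `terminatesNabla_of_stepMeasure`;
cf. `terminates_of_stateMeasure` of `MarkedTransferCampaignW46PermissibleReduction` for permissible runs);
the tame-regime measure for a typed rung (iv) is not constructed here. (iv-c) MONOTONICITY: raising `C` shrinks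
`Regime.charGT n C`, so every shape is inherited upward (`…_charGT_mono`); the honest `C` of a rung is the least one
proved, and V5's `b!`-type thresholds sit inside the `b`-threshold (`Regime.charGT_of_le`).

References: plan/RESCUE-SEED.md §1 W4.6; L/res-L0-k46/KILL-TEST-K4.6.md §4 (index only); module docstring (M)/(REG)
(iv)/(VAC) of `MarkedTransferCampaignW46TypedProcedure`; D1 (res-L1-s47-dis-1). H. Hironaka, ms. 2017-03-23: Th. 16.6
(2)/(4) p.84 l.10–20, l.29; Def. 15.11/15.12 p.80 l.29 – p.81 l.4 — quoted for scope only, under adjudication, not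
cited as fact [Hironaka2017]. Bierstone–Grigoriev–Milman–Włodarczyk, arXiv:1206.3090, Cor. 7.0.6 / 8.0.6 — through the
tree's PROVED `BierstoneGrigorievMilmanWlodarczyk2011_holds` only [BierstoneGrigorievMilmanWlodarczyk2011].
-/

noncomputable section

set_option linter.dupNamespace false -- mandated namespace of this single-conjunct summit

open CategoryTheory AlgebraicGeometry TopologicalSpace

namespace Summit.ResolutionOfSingularities.ResolutionOfSingularities.Theorems
namespace CampaignW46

open Literature.AlgebraicGeometry.Resolution
open Literature.AlgebraicGeometry.Hironaka2017 (S02Preliminaries.closedPoints)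
open Literature.AlgebraicGeometry.Hironaka2017.S02Preliminaries hiding closedPoints
open Literature.AlgebraicGeometry.Hironaka2017.Datum
open Literature.AlgebraicGeometry.Hironaka2017.S15ARSchemes
open Literature.AlgebraicGeometry.Hironaka2017.S16Proof

universe u

/-! ## (iv-b) The 0-padded string order: nothing is `<_lex` the empty string -/

section Order

variable {n : ℕ}

/-- Elementary: the 0-padded key of the empty `Inv`-string is the zero key at every index (row 019
`InvString.padKey`, «adding (0) repeatedly»). [folklore] -/
theorem invString_padKey_nil (i : ℕ) :
    InvString.padKey ([] : List (EdgeInv n)) i = toLex (fun _ => 0) := by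
  simp [InvString.padKey]

/-- Elementary: the zero key is the least 0-padded key — no padded entry of any string lies strictly below it.
[folklore] -/
theorem not_padKey_lt_zero (L : List (EdgeInv n)) (i : ℕ) :
    ¬ InvString.padKey L i < toLex (fun _ : Fin (n + 2) => (0 : ℕ)) := by
  intro h
  have hle : toLex (fun _ : Fin (n + 2) => (0 : ℕ)) ≤ InvString.padKey L i := by
    rw [← toLex_ofLex (InvString.padKey L i)]
    exact Pi.toLex_monotone fun _ => Nat.zero_le _
  exact lt_irrefl _ (lt_of_le_of_lt hle h)

/-- **No `Inv`-string is `<_lex` the EMPTY string** (row 019 `InvString.LexLT`, the comparison of Eq. (127) p.84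
l.10–20 with 0-padding): after padding, the empty string is the constant zero string, the bottom of the order.
[folklore] -/
theorem invString_not_lexLT_nil (L : List (EdgeInv n)) : ¬ InvString.LexLT L [] := by
  rintro ⟨i, -, hi⟩
  rw [invString_padKey_nil] at hi
  exact not_padKey_lt_zero L i hi

/-- Elementary: the string of length `0` of any row-019 résumé is empty. [folklore] -/
theorem mtiDatum_invStr_zero {Z : Scheme.{u}} (S : MTIDatum Z n) (ξ : Z) : S.invStr 0 ξ = [] := rfl

/-- **Eq. (127) against a résumé with `m = 0` stops is unsatisfiable** (row 019 `Eq127`): the unprimed string is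
empty. [folklore] -/
theorem not_eq127_of_m_eq_zero {Z Z' : Scheme.{u}} (S : MTIDatum Z n) (hm : S.m = 0) (ξ : Z) (S' : MTIDatum Z' n)
    (ξ' : Z') : ¬ Eq127 S ξ S' ξ' := by
  unfold Eq127
  rw [hm, mtiDatum_invStr_zero]
  exact invString_not_lexLT_nil _

end Order

/-! ## (iv-b) `D′ = ∅` for the ∇-centred step with irreducible `∇` (Th. 16.6 (4) p.84 l.29 «`D = ∇` and hence `∇′ = ∅`») -/

section DPrime

variable {n : ℕ}

/-- Pure topology: if the terminal plat lies inside the centre, its strict transform is empty (row 019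
`MTIDatum.nablaPrime` = tree `strictTransformSet` = closure of `π⁻¹(∇ ∖ D)`). [folklore] -/
theorem mtiDatum_nablaPrime_eq_empty {Z Z' : Scheme.{u}} (S : MTIDatum Z n) (π : Z' ⟶ Z) (D : Closeds Z)
    (h : (S.nabla : Set Z) ⊆ (D : Set Z)) : S.nablaPrime π D = ∅ := by
  unfold MTIDatum.nablaPrime strictTransformSet
  have hdiff : (S.nabla : Set Z) \ (D : Set Z) = ∅ := by
    ext x
    simp only [Set.mem_sdiff, Set.mem_empty_iff_false, iff_false, not_and, not_not]
    exact fun hx => h hx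
  rw [hdiff, Set.preimage_empty, closure_empty]

/-- Pure topology: hence `D′ = ∇′ ∩ π⁻¹(D) = ∅` (row 019 `MTIDatum.DPrime`) — the typed form of «`D = ∇` and hence
`∇′ = ∅`» (p.84 l.29). [folklore] -/
theorem mtiDatum_dPrime_eq_empty {Z Z' : Scheme.{u}} (S : MTIDatum Z n) (π : Z' ⟶ Z) (D : Closeds Z)
    (h : (S.nabla : Set Z) ⊆ (D : Set Z)) : S.DPrime π D = ∅ := by
  unfold MTIDatum.DPrime
  rw [mtiDatum_nablaPrime_eq_empty S π D h, Set.empty_inter]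

end DPrime

variable {n : ℕ} {p : ℕ} [Fact p.Prime] {K : Type u} [Field K] [CharP K p]

/-! ## (iv-b) «terminal at stage 0» = «`m = 0`» and what Eq. (127)-for-a-step then says -/

section Tame

variable {N : Notions.{u} n} {A A' : AmbientDatum p K} {E : IdealExponent A.Z}

/-- [OURS · L1 W4.6 (iv); NOT a statement of the manuscript] **The classical / tame résumé in the typed vocabulary.**
The number of stops `m` of a résumé (DESIGN POINT (M): `m := t`, the terminal index of Def. 15.11, row 094
`YTerminal`) is `0` iff the termination criterion already holds at stage `0`: «every member `F(0;j)` of `𝔜(0)` has the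
`℘(F(0)_j)` generated by `℘(F(0)_j, 1)`» (row 091 `YSequence.genDegOne 0`) — the situation with NO wild exponent
`q = p^e > 1` anywhere in `𝔜(0)`, which is what «`p` large relative to every order in sight» is meant to produce.
[folklore] -/
theorem Resume.m_eq_zero_iff_genDegOne_zero (R : Resume N A E) : R.m = 0 ↔ R.𝒴.genDegOne 0 := by
  constructor
  · intro h
    have ht : R.T.t = 0 := h
    have := R.T.terminates
    rwa [ht] at this
  · intro h0
    by_contra hne
    exact R.T.first 0 (Nat.pos_of_ne_zero hne) h0

/-- Pure logic: the row-019 résumé of a résumé has the same number of stops. [folklore] -/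
theorem Resume.mti_m (R : Resume N A E) : R.mti.m = R.m := rfl

/-- [OURS · L1 W4.6 (iv); NOT a statement of the manuscript] **Eq. (127) for a step from a résumé terminal at stage
`0` holds iff no closed point lies over the centre off `D′`.** With `m = 0` the unprimed `Inv`-string is empty, so the
displayed inequality (127) is unsatisfiable at every point of its locus (`not_eq127_of_m_eq_zero`); the typed
`Step.Decrease` (= row 019 `Thm16_6_2` at the step) is then exactly the emptiness of the locus
`{ξ′ closed, π ξ′ ∈ D, ξ′ ∉ D′}`. [folklore] -/
theorem Step.decrease_iff_of_m_eq_zero {R : Resume N A E} (s : Step R A') (R' : Resume N A' s.E')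
    (hm : R.m = 0) :
    s.Decrease R' ↔ ∀ ξ' : A'.Z, ξ' ∈ S02Preliminaries.closedPoints A'.Z → s.π ξ' ∈ (s.D : Set A.Z) →
      ξ' ∈ R.mti.DPrime s.π s.D := by
  constructor
  · intro h ξ' hcl hD
    by_contra hnot
    exact not_eq127_of_m_eq_zero R.mti (R.mti_m.trans hm) _ _ _ (h ξ' hcl hD hnot)
  · intro h ξ' hcl hD hnot
    exact absurd (h ξ' hcl hD) hnot

/-- Pure logic: the clause «`m′ ≤ m`» for a step from a résumé terminal at stage `0` says the primed résumé is
terminal at stage `0` too, at every point of the locus (row 019 `Thm16_6_2_mle`). [folklore] -/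
theorem Step.lengthLe_iff_of_m_eq_zero {R : Resume N A E} (s : Step R A') (R' : Resume N A' s.E')
    (hm : R.m = 0) :
    s.LengthLe R' ↔ ∀ ξ' : A'.Z, ξ' ∈ S02Preliminaries.closedPoints A'.Z → s.π ξ' ∈ (s.D : Set A.Z) →
      ξ' ∉ R.mti.DPrime s.π s.D → R'.m = 0 := by
  constructor
  · intro h ξ' hcl hD hnot
    have := h ξ' hcl hD hnot
    change R'.m ≤ R.mti.m at this
    rw [R.mti_m, hm] at this
    exact Nat.le_zero.mp this
  · intro h ξ' hcl hD hnot
    change R'.m ≤ R.mti.m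
    rw [R.mti_m, hm, h ξ' hcl hD hnot]

/-- [OURS · L1 W4.6 (iv); NOT a statement of the manuscript] **The ∇-centred step from a tame résumé.** If the
centre contains the terminal plat (Th. 16.6 (4) «`D = ∇`», so `D = ∇(E)` as sets by the centre rule) and the résumé is
terminal at stage `0`, then `D′ = ∅` and Eq. (127)-for-the-step holds iff NO closed point of `Z′` lies over the centre.
[folklore] -/
theorem Step.decrease_iff_of_m_eq_zero_of_nabla_subset {R : Resume N A E} (s : Step R A') (R' : Resume N A' s.E')
    (hm : R.m = 0) (hD : (R.nabla : Set A.Z) ⊆ (s.D : Set A.Z)) :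
    s.Decrease R' ↔ ∀ ξ' : A'.Z, ξ' ∈ S02Preliminaries.closedPoints A'.Z → s.π ξ' ∉ (s.D : Set A.Z) := by
  rw [s.decrease_iff_of_m_eq_zero R' hm]
  have hempty : R.mti.DPrime s.π s.D = ∅ := mtiDatum_dPrime_eq_empty R.mti s.π s.D hD
  constructor
  · intro h ξ' hcl hDξ
    have := h ξ' hcl hDξ
    rw [hempty] at this
    exact this
  · intro h ξ' hcl hDξ
    exact absurd hDξ (h ξ' hcl)

/-- Pure logic: a component of an IRREDUCIBLE terminal plat is all of it (`IsNablaComponent.maximal` with `S := ∇`), so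
the ∇-centred step of `StepNabla` has `∇ ⊆ D` whenever `∇(E)` is irreducible. [folklore] -/
theorem IsNablaComponent.nabla_subset_of_isIrreducible {R : Resume N A E} {D : Closeds A.Z}
    (h : IsNablaComponent R D) (hirr : IsIrreducible (R.nabla : Set A.Z)) :
    (R.nabla : Set A.Z) ⊆ (D : Set A.Z) :=
  (h.maximal _ hirr h.subset_nabla subset_rfl).le

/-- [OURS · L1 W4.6 (iv); NOT a statement of the manuscript] The same for a ∇-step (`StepNabla`) with irreducible
`∇(E)`: Eq. (127) for it, from a résumé terminal at stage `0`, holds iff no closed point lies over the centre.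
[folklore] -/
theorem StepNabla.decrease_iff_of_m_eq_zero {R : Resume N A E} (s : StepNabla R A') (R' : Resume N A' s.toStep.E')
    (hm : R.m = 0) (hirr : IsIrreducible (R.nabla : Set A.Z)) :
    s.toStep.Decrease R' ↔ ∀ ξ' : A'.Z, ξ' ∈ S02Preliminaries.closedPoints A'.Z → s.π ξ' ∉ (s.D : Set A.Z) :=
  s.toStep.decrease_iff_of_m_eq_zero_of_nabla_subset R' hm (s.component.nabla_subset_of_isIrreducible hirr)

end Tame

/-! ## (iv-b) One tame witness refutes the one-step rung shape, in every regime containing it -/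

section Witness

variable {N : Notions.{u} n} {Rd : Reading p K N}

/-- [OURS · L1 W4.6 (iv); NOT a statement of the manuscript] **A tame witness refutes `DecreaseAlongSteps`.** For a
notion instance `N`, a reading `Rd` and a regime `Rg`: a state `(A, E)` in `Rg` with a résumé `R` read by `Rd` and
terminal at stage `0` (`R.m = 0`), a step `s` from it, a résumé `R′` of the transform read by `Rd`, and a closed point
`ξ′` of `Z′` over the centre off `D′` together contradict `DecreaseAlongSteps N Rd Rg` (design point (M)). This is the
typed content of «in the char-0-like regime the (127)-certificate has nothing to decrease»; it is NOT a statement about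
termination. [folklore] -/
theorem not_decreaseAlongSteps_of_tameWitness {Rg : Regime p K} {A : AmbientDatum p K} {E : IdealExponent A.Z}
    (R : Resume N A E) (hRg : Rg A E) (hRd : Rd A E R) (hm : R.m = 0) {A' : AmbientDatum p K} (s : Step R A')
    (R' : Resume N A' s.E') (hRd' : Rd A' s.E' R') {ξ' : A'.Z} (hcl : ξ' ∈ S02Preliminaries.closedPoints A'.Z)
    (hD : s.π ξ' ∈ (s.D : Set A.Z)) (hD' : ξ' ∉ R.mti.DPrime s.π s.D) : ¬ DecreaseAlongSteps N Rd Rg :=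
  fun h => hD' ((s.decrease_iff_of_m_eq_zero R' hm).mp (h A E R hRg hRd A' s R' hRd').1 ξ' hcl hD)

/-- [OURS · L1 W4.6 (iv); NOT a statement of the manuscript] The ∇-centred form: with `∇(E) ⊆ D` the witness is just
a closed point over the centre. [folklore] -/
theorem not_decreaseAlongSteps_of_tameWitness_nabla {Rg : Regime p K} {A : AmbientDatum p K}
    {E : IdealExponent A.Z} (R : Resume N A E) (hRg : Rg A E) (hRd : Rd A E R) (hm : R.m = 0)
    {A' : AmbientDatum p K} (s : Step R A') (hDn : (R.nabla : Set A.Z) ⊆ (s.D : Set A.Z))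
    (R' : Resume N A' s.E') (hRd' : Rd A' s.E' R') {ξ' : A'.Z} (hcl : ξ' ∈ S02Preliminaries.closedPoints A'.Z)
    (hD : s.π ξ' ∈ (s.D : Set A.Z)) : ¬ DecreaseAlongSteps N Rd Rg :=
  fun h => ((s.decrease_iff_of_m_eq_zero_of_nabla_subset R' hm hDn).mp (h A E R hRg hRd A' s R' hRd').1 ξ' hcl) hD

/-- [OURS · L1 W4.6 (iv); NOT a statement of the manuscript] **Rung (iv) in the (127)-reading dies on a tame
witness**: the specialisation of `not_decreaseAlongSteps_of_tameWitness` to the large-characteristic regime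
`Regime.charGT n C` («`C n b < p`», EXPLICIT `C`), for every threshold `C`. [folklore] -/
theorem not_decreaseAlongSteps_charGT_of_tameWitness (C : ℕ → ℕ → ℕ) {A : AmbientDatum p K}
    {E : IdealExponent A.Z} (hC : C n E.b < p) (R : Resume N A E) (hRd : Rd A E R) (hm : R.m = 0)
    {A' : AmbientDatum p K} (s : Step R A') (R' : Resume N A' s.E') (hRd' : Rd A' s.E' R') {ξ' : A'.Z}
    (hcl : ξ' ∈ S02Preliminaries.closedPoints A'.Z) (hD : s.π ξ' ∈ (s.D : Set A.Z)) (hD' : ξ' ∉ R.mti.DPrime s.π s.D) :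
    ¬ DecreaseAlongSteps N Rd (Regime.charGT n C) :=
  not_decreaseAlongSteps_of_tameWitness (Rg := Regime.charGT n C) R hC hRd hm s R' hRd' hcl hD hD'

end Witness

/-! ## (iv-c) Monotonicity in the threshold -/

section Threshold

variable {N : Notions.{u} n} {Rd : Reading p K N}

/-- Pure logic: a larger threshold gives a smaller large-characteristic regime. [folklore] -/
theorem Regime.charGT_of_le {C C' : ℕ → ℕ → ℕ} (hle : ∀ b, C n b ≤ C' n b) (A : AmbientDatum p K)
    (E : IdealExponent A.Z) (h : Regime.charGT (p := p) (K := K) n C' A E) : Regime.charGT n C A E :=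
  lt_of_le_of_lt (hle E.b) h

/-- [OURS · L1 W4.6 (iv); NOT a statement of the manuscript] The one-step shape is inherited by every larger
threshold (the honest `C` of a rung is the least one proved). [folklore] -/
theorem decreaseAlongSteps_charGT_mono {C C' : ℕ → ℕ → ℕ} (hle : ∀ b, C n b ≤ C' n b)
    (h : DecreaseAlongSteps N Rd (Regime.charGT n C)) : DecreaseAlongSteps N Rd (Regime.charGT n C') :=
  decreaseAlongSteps_antitone (fun A E hE => Regime.charGT_of_le hle A E hE) h

/-- [OURS · L1 W4.6 (iv); NOT a statement of the manuscript] Sub-centre termination is inherited by every larger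
threshold. [folklore] -/
theorem terminates_charGT_mono {C C' : ℕ → ℕ → ℕ} (hle : ∀ b, C n b ≤ C' n b)
    (h : Terminates N Rd (Regime.charGT n C)) : Terminates N Rd (Regime.charGT n C') :=
  terminates_antitone (fun A E hE => Regime.charGT_of_le hle A E hE) h

/-- [OURS · L1 W4.6 (iv); NOT a statement of the manuscript] ∇-centred termination is inherited by every larger
threshold. [folklore] -/
theorem terminatesNabla_charGT_mono {C C' : ℕ → ℕ → ℕ} (hle : ∀ b, C n b ≤ C' n b)
    (h : TerminatesNabla N Rd (Regime.charGT n C)) : TerminatesNabla N Rd (Regime.charGT n C') :=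
  terminatesNabla_antitone (fun A E hE => Regime.charGT_of_le hle A E hE) h

end Threshold

/-! ## (iv-d) How a termination rung IS proved in the typed vocabulary: a strictly decreasing state measure -/

section Measure

variable {N : Notions.{u} n} {Rd : Reading p K N}

/-- Elementary: no sequence of natural numbers decreases strictly at every step. [folklore] -/
theorem not_forall_succ_lt (f : ℕ → ℕ) : ¬ ∀ k, f (k + 1) < f k := by
  intro h
  have key : ∀ k, f k + k ≤ f 0 := by
    intro k
    induction k with
    | zero => simp
    | succ k ih => have := h k; omega
  have := key (f 0 + 1)
  omega

/-- [OURS · L1 W4.6; NOT a statement of the manuscript] **Termination from a state measure along typed steps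
(sub-centre runs).** If a natural-number measure of the STATE `(A, E)` drops strictly along every STEP of the typed
procedure (centre admitted by the rule at a résumé read by `Rd`) between states of the regime, then the procedure
terminates in the regime (`Terminates`; sibling of `MarkedTransferCampaignW46PermissibleReduction`'s
`terminates_of_stateMeasure`, which asks the drop for EVERY permissible blow-up — here only along typed steps). This is the shape in
which a rung proves «hence terminates» (Th. 16.13-role) WITHOUT the `Inv`-string: rung (ii) at `p = 2` uses the Milnor
number (res-L1-s46-pv-4), rung (iii) the number of singular points (res-L1-s46-pv-5); a rung (iv) about the typed
procedure needs such a measure in the tame regime (classically: the order of contact with the maximal-contact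
hypersurface), which this file does not construct. [folklore] -/
theorem terminates_of_stepMeasure (Rg : Regime p K) (μ : ∀ A : AmbientDatum p K, IdealExponent A.Z → ℕ)
    (h : ∀ (A : AmbientDatum p K) (E : IdealExponent A.Z) (R : Resume N A E), Rg A E → Rd A E R →
      ∀ (A' : AmbientDatum p K) (s : Step R A'), Rg A' s.E' → μ A' s.E' < μ A E) :
    Terminates N Rd Rg := by
  intro r hr
  refine not_forall_succ_lt (fun k => μ (r.A k) (r.E k)) fun k => ?_
  have hk : Rg (r.A (k + 1)) (r.step k).E' := by rw [← r.E_succ k]; exact hr (k + 1)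
  have := h (r.A k) (r.E k) (r.R k) (hr k) (r.reads k) (r.A (k + 1)) (r.step k) hk
  simpa only [r.E_succ k] using this

/-- [OURS · L1 W4.6; NOT a statement of the manuscript] **Termination from a state measure, ∇-centred runs** (the
repaired reading D1, `TerminatesNabla`): it suffices that the measure drops along every ∇-STEP (centre = a component
of the terminal plat) between states of the regime. [folklore] -/
theorem terminatesNabla_of_stepMeasure (Rg : Regime p K) (μ : ∀ A : AmbientDatum p K, IdealExponent A.Z → ℕ)
    (h : ∀ (A : AmbientDatum p K) (E : IdealExponent A.Z) (R : Resume N A E), Rg A E → Rd A E R →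
      ∀ (A' : AmbientDatum p K) (s : StepNabla R A'), Rg A' s.toStep.E' → μ A' s.toStep.E' < μ A E) :
    TerminatesNabla N Rd Rg := by
  intro r hr
  refine not_forall_succ_lt (fun k => μ (r.A k) (r.E k)) fun k => ?_
  have hk : Rg (r.A (k + 1)) (r.step k).toStep.E' := by rw [← r.E_succ k]; exact hr (k + 1)
  have := h (r.A k) (r.E k) (r.R k) (hr k) (r.reads k) (r.A (k + 1)) (r.step k) hk
  simpa only [r.E_succ k] using this

end Measure

/-! ## (iv-a) The existence side of rung (iv) is a theorem of the tree -/

section Existence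

/-- [OURS · L1 W4.6 (iv); NOT a statement of the manuscript] **Large characteristic relative to dimension and degree,
HYPERSURFACES — existence of a resolution (re-export of a tree theorem in the campaign's shape «`p > C(n, d)`»).** For
every `n d` there is `p₀` such that for every prime `p > p₀`, every perfect field `k` of characteristic `p` and every
polynomial `f ∈ k[x_1, …, x_n]` of total degree `≤ d` whose zero scheme `V(f) ⊆ 𝔸ⁿ_k` is integral, `V(f)` has a
resolution of singularities (`Scheme.HasResolution`: a proper birational morphism from a regular scheme). PROOF: the
tree's `BierstoneGrigorievMilmanWlodarczyk2011_holds` at `l = 1`. HONEST `C`: the tree's proof is by Noetherian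
induction over the coefficient space from Kollár's characteristic-zero theorems, so `p₀` is NOT explicit here; nothing of
the typed Th. 16.6 procedure is used or concluded. [folklore] -/
theorem largeChar_hypersurface_hasResolution (n d : ℕ) :
    ∃ p₀ : ℕ, ∀ (p : ℕ), p.Prime → p₀ < p → ∀ (k : Type) [Field k] [CharP k p] [PerfectField k]
      (f : MvPolynomial (Fin n) k), f.totalDegree ≤ d → IsIntegral (affineZeroLocus k n {f}) →
        Scheme.HasResolution (affineZeroLocus k n {f}) := by
  obtain ⟨M, hM⟩ := BierstoneGrigorievMilmanWlodarczyk2011_holds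
  refine ⟨M d n 1, fun p hp hlt k _ _ _ f hf hint => ?_⟩
  exact hM p hp k n d 1 {f} (by simp) (by simpa using hf) hlt hint

/-- [OURS · L1 W4.6 (iv); NOT a statement of the manuscript] The same for bounded complexity `(n, d, l)`: for every
`n d l` there is `p₀` such that every integral `Y = Spec k[x]/(S) ⊆ 𝔸ⁿ_k`, `|S| ≤ l`, degrees `≤ d`, over a perfect
field of characteristic `p > p₀`, has a resolution (the tree's theorem with the threshold quantifier moved inside).
[folklore] -/
theorem largeChar_boundedComplexity_hasResolution (n d l : ℕ) :
    ∃ p₀ : ℕ, ∀ (p : ℕ), p.Prime → p₀ < p → ∀ (k : Type) [Field k] [CharP k p] [PerfectField k]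
      (S : Finset (MvPolynomial (Fin n) k)), S.card ≤ l → (∀ f ∈ S, f.totalDegree ≤ d) →
        IsIntegral (affineZeroLocus k n S) → Scheme.HasResolution (affineZeroLocus k n S) := by
  obtain ⟨M, hM⟩ := BierstoneGrigorievMilmanWlodarczyk2011_holds
  exact ⟨M d n l, fun p hp hlt k _ _ _ S hS hd hint => hM p hp k n d l S hS hd hlt hint⟩

end Existence

end CampaignW46
end Summit.ResolutionOfSingularities.ResolutionOfSingularities.Theorems

end
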